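import Summits.AtomisticToContinuum.FouriersLaw.Theorems.JunctionLocalityNonBallisticStubDrudeFromTruncationRegularAux2

/-!
# Stub `stub_drudeFromTruncationRegular` (DFT′) of line `drude-controls-conductance` (R3b) — crux
`JunctionLocality.NonBallistic` (stmt-AtomisticToContinuum-9127), part 3: the `L → ∞` exchange in the
truncated Cesàro means

Helper file (`--supports stmt-AtomisticToContinuum-9127`); nothing here closes the item.

`cesaro_tsum_cov_clipCurrent_le` (= the registered sub-goal `stub_truncatedCesaroBoxLimit`): the Cesàro bound of
the `NoTruncatedDrude` body, stated with the box observable `G_L = Σ_{|x| ≤ L} clip_M ∘ j_x`, passes to the limit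
`L → ∞` at fixed `τ`: `|τ⁻¹∫₀^τ Σ_x Cov(a_M, a_M ∘ φ_t ∘ τ_x) dt| ≤ η`, `a_M = clip_M ∘ j₀` (bilinearity and
shift invariance identify `Cov(a_M ∘ φ_t, G_L)` with the box partial sum; the terms are continuous in `t` and
dominated on `|t| ≤ |τ|` by a summable clustering majorant, so dominated convergence applies in `t`).
-/

noncomputable section

namespace Summit.AtomisticToContinuum.FouriersLaw.Theorems.NonBallistic.DrudeFromTruncation

open MeasureTheory ProbabilityTheory Filter Topology Set Function
open scoped NNReal ENNReal InnerProductSpace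
open Literature.MathematicalPhysics.KineticTheory
open Literature.MathematicalPhysics.KineticTheory.HeatConduction

/-! ### §3 The `L → ∞` exchange in the truncated Cesàro means -/

/-- On the integration range `Ι 0 τ` one has `|t| ≤ |τ|`. [folklore] -/
theorem abs_le_abs_of_mem_uIoc {t τ : ℝ} (ht : t ∈ Set.uIoc (0 : ℝ) τ) : |t| ≤ |τ| := by
  rcases Set.mem_uIoc.1 ht with h | h
  · rw [abs_of_pos h.1]
    exact h.2.trans (le_abs_self τ)
  · rw [abs_of_nonpos h.2, abs_of_neg (h.1.trans_le h.2)]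
    linarith [h.1]

/-- **The truncated Cesàro bound passes to the limit `L → ∞` at fixed `τ`.** In the setting of
`exists_zeroWavenumberData_clipCurrent`, suppose that for `τ ≥ τ₀` the Cesàro means
`τ⁻¹∫₀^τ Cov_μ(a_M ∘ φ_t, G_L) dt` of the covariance of the evolved clipped current with the box observable
`G_L = Σ_{|x| ≤ L} clip_M ∘ j_x` are bounded by `η` in absolute value for all large `L` (the body of
`NoTruncatedDrude`). Then `|τ⁻¹∫₀^τ Σ_{x ∈ ℤ} Cov_μ(a_M, (a_M ∘ φ_t) ∘ τ_x) dt| ≤ η` for `τ ≥ τ₀`: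
`Cov_μ(a_M ∘ φ_t, G_L) = Σ_{|x| ≤ L} Cov_μ(a_M, (a_M ∘ φ_t) ∘ τ_x)` (bilinearity, shift invariance,
`φ_t ∘ τ_x = τ_x ∘ φ_t`, symmetry of the box), the terms are continuous in `t` and dominated on
`|t| ≤ |τ|` by a summable clustering majorant, so the `t`-integrals converge as `L → ∞` (dominated
convergence). [folklore] -/
theorem cesaro_tsum_cov_clipCurrent_le {P : OscillatorChain} {s₁ s₂ : ℕ} (hs₁ : 1 ≤ s₁)
    (hs₂ : 1 ≤ s₂) (hU1 : OscillatorChain.IsEvenPolyOfDegree P.U s₁)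
    (hV1 : OscillatorChain.IsEvenPolyOfDegree P.V s₂) (D : InfiniteChainDynamics P)
    (hcar : D.carrier = P.bmGood) (hid : ∀ (t : ℝ) (σ : ChainConfig), σ ∉ P.bmGood → D.flow t σ = σ)
    {T : ℝ} {μ : Measure ChainConfig} (hG : P.IsChainGibbsMeasure T μ) (hS : IsShiftInvariant μ)
    (hss : P.HasSuperstabilityEstimate μ) (hD : D.PreservesMeasure μ) {C m : ℝ} (hC : 0 ≤ C) (hm : 0 < m)
    (hmix : ∀ (a : ℤ) (n : ℕ) (f g : ChainConfig → ℝ),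
      DependsOn f {i : ℤ | i ≤ a} → DependsOn g {i : ℤ | a + n ≤ i} → Measurable f → Measurable g →
      MemLp f 2 μ → MemLp g 2 μ →
      |∫ σ, f σ * g σ ∂μ - (∫ σ, f σ ∂μ) * ∫ σ, g σ ∂μ| ≤
        C * Real.exp (-(m * n)) * (∫ σ, f σ ^ 2 ∂μ) ^ (1 / 2 : ℝ) * (∫ σ, g σ ^ 2 ∂μ) ^ (1 / 2 : ℝ))
    {M : ℝ} (hM : 0 < M) {η : ℝ}
    (hH : ∃ τ₀ : ℝ, ∀ τ : ℝ, τ₀ ≤ τ → ∃ L₀ : ℕ, ∀ L : ℕ, L₀ ≤ L →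
      |τ⁻¹ * ∫ t in (0:ℝ)..τ,
        ((∫ σ, max (-M) (min M (P.bondCurrentZ (D.flow t σ) 0)) *
            (∑ x ∈ Finset.Icc (-(L : ℤ)) (L : ℤ), max (-M) (min M (P.bondCurrentZ σ x))) ∂μ) -
          (∫ σ, max (-M) (min M (P.bondCurrentZ (D.flow t σ) 0)) ∂μ) *
            (∫ σ, ∑ x ∈ Finset.Icc (-(L : ℤ)) (L : ℤ), max (-M) (min M (P.bondCurrentZ σ x)) ∂μ))| ≤ η) :
    ∃ τ₀ : ℝ, ∀ τ : ℝ, τ₀ ≤ τ →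
      |τ⁻¹ * ∫ t in (0:ℝ)..τ, (∑' x : ℤ,
        cov[(fun σ : ChainConfig => max (-M) (min M (P.bondCurrentZ σ 0))),
          ((fun σ : ChainConfig => max (-M) (min M (P.bondCurrentZ σ 0))) ∘ D.flow t) ∘ chainShift x; μ])| ≤
        η := by
  haveI : IsProbabilityMeasure μ := hss.1
  have hU0 : ∀ r, 0 ≤ P.U r := hU1.choose_spec.2.2
  have hV0 : ∀ r, 0 ≤ P.V r := hV1.choose_spec.2.2
  have hτ : ∀ x : ℤ, MeasurePreserving (chainShift x) μ μ := hS.measurePreserving_chainShift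
  set a : ChainConfig → ℝ := fun σ => max (-M) (min M (P.bondCurrentZ σ 0)) with ha
  have ham : Measurable a := measurable_clipCurrent P M 0
  have had : DependsOn a (Icc (-1 : ℤ) 1) := dependsOn_clipCurrent P M
  have ha2 : MemLp a 2 μ := memLp_clipCurrent hM.le 0 2
  have hbx : ∀ (x : ℤ) (σ : ChainConfig), max (-M) (min M (P.bondCurrentZ σ x)) = a (chainShift x σ) := by
    intro x σ
    rw [ha]
    simp only [OscillatorChain.bondCurrentZ_chainShift, zero_add]
  obtain ⟨τ₀, hτ₀⟩ := hH
  refine ⟨τ₀, fun τ hτle => ?_⟩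
  obtain ⟨L₀, hL₀⟩ := hτ₀ τ hτle
  -- the terms `c t x = Cov_μ(a, (a ∘ φ_t) ∘ τ_x)` and their continuity in `t`
  set c : ℝ → ℤ → ℝ := fun t x => cov[a, (a ∘ D.flow t) ∘ chainShift x; μ] with hc
  have hccont : ∀ x : ℤ, Continuous fun t : ℝ => c t x := fun x =>
    continuous_cov_flow_chainShift D hU0 hV0 hcar hid hτ hD ham ha2
      (continuous_integral_clipCurrent_mul_flow hV1 D hD hM.le) x
  -- (1) the hypothesis' covariance is the box partial sum of the `c t x`
  have hE1 : ∀ (L : ℕ) (t : ℝ),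
      (∫ σ, a (D.flow t σ) * (∑ x ∈ Finset.Icc (-(L : ℤ)) (L : ℤ), max (-M) (min M (P.bondCurrentZ σ x))) ∂μ) -
        (∫ σ, a (D.flow t σ) ∂μ) *
          (∫ σ, ∑ x ∈ Finset.Icc (-(L : ℤ)) (L : ℤ), max (-M) (min M (P.bondCurrentZ σ x)) ∂μ) =
      ∑ x ∈ Finset.Icc (-(L : ℤ)) (L : ℤ), c t x := by
    intro L t
    set I : Finset ℤ := Finset.Icc (-(L : ℤ)) (L : ℤ) with hI
    have hat2 : MemLp (a ∘ D.flow t) 2 μ := ha2.comp_measurePreserving (hD.2 t)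
    have hax2 : ∀ x : ℤ, MemLp (a ∘ chainShift x) 2 μ := fun x => ha2.comp_measurePreserving (hτ x)
    have hint1 : ∀ x : ℤ, Integrable (fun σ => (a ∘ D.flow t) σ * (a ∘ chainShift x) σ) μ := fun x =>
      hat2.integrable_mul (hax2 x)
    have hint2 : ∀ x : ℤ, Integrable (a ∘ chainShift x) μ := fun x => (hax2 x).integrable one_le_two
    simp only [hbx]
    have e1 : (∫ σ, a (D.flow t σ) * ∑ x ∈ I, a (chainShift x σ) ∂μ) =
        ∑ x ∈ I, ∫ σ, (a ∘ D.flow t) σ * (a ∘ chainShift x) σ ∂μ := by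
      rw [← integral_finsetSum I (fun x _ => hint1 x)]
      refine integral_congr_ae (Eventually.of_forall fun σ => ?_)
      simp only [comp_apply, Finset.mul_sum]
    have e2 : (∫ σ, ∑ x ∈ I, a (chainShift x σ) ∂μ) = ∑ x ∈ I, ∫ σ, (a ∘ chainShift x) σ ∂μ :=
      integral_finsetSum I (fun x _ => hint2 x)
    -- each term is `c t (-x)`
    have hx : ∀ x : ℤ, (∫ σ, (a ∘ D.flow t) σ * (a ∘ chainShift x) σ ∂μ) -
        (∫ σ, a (D.flow t σ) ∂μ) * (∫ σ, (a ∘ chainShift x) σ ∂μ) = c t (-x) := by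
      intro x
      have hfun : ((a ∘ D.flow t) ∘ chainShift (-x)) ∘ chainShift x = a ∘ D.flow t := by
        rw [comp_assoc, chainShift.neg_comp, comp_id]
      have h0 := covariance_comp_measurePreserving (hτ x) ha2.aestronglyMeasurable
        ((hat2.comp_measurePreserving (hτ (-x))).aestronglyMeasurable)
      rw [hfun] at h0
      show _ = cov[a, (a ∘ D.flow t) ∘ chainShift (-x); μ]
      rw [← h0, covariance_comm, covariance_eq_sub hat2 (hax2 x)]
      rfl
    rw [e1, e2, Finset.mul_sum, ← Finset.sum_sub_distrib, Finset.sum_congr rfl fun x _ => hx x]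
    exact Finset.sum_equiv (Equiv.neg ℤ) (fun x => by simp only [hI, Finset.mem_Icc, Equiv.neg_apply]; omega)
      (fun x _ => by simp only [Equiv.neg_apply])
  -- (2) the uniform summable majorant on `|t| ≤ |τ|`
  obtain ⟨Fm, hFs, hFb⟩ := D.exists_summable_majorant_cov_flow hτ hD hC hm hmix ham had ha2
    (exists_l2_locality_clipCurrent hs₁ hs₂ hU1 hV1 D hcar hG hss hD hM.le |τ| (abs_nonneg τ))
  have hFm0 : ∀ w, 0 ≤ Fm w := fun w => (abs_nonneg _).trans (hFb 0 (by simp) w)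
  have hsumc : ∀ t : ℝ, |t| ≤ |τ| → Summable (c t) := fun t ht =>
    Summable.of_norm_bounded hFs (fun w => by rw [Real.norm_eq_abs]; exact hFb t ht w)
  have hQbound : ∀ (L : ℕ) (t : ℝ), |t| ≤ |τ| → |∑ x ∈ Finset.Icc (-(L : ℤ)) (L : ℤ), c t x| ≤ ∑' w, Fm w := by
    intro L t ht
    refine (Finset.abs_sum_le_sum_abs _ _).trans ?_
    refine (Finset.sum_le_sum fun x _ => hFb t ht x).trans ?_
    exact hFs.sum_le_tsum _ (fun w _ => hFm0 w)
  -- the boxes `{-L, …, L}` exhaust `ℤ` (as in `Literature.NumberTheory.LFunctions.FordVK.tendsto_Icc_neg_atTop`)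
  have hIcc : Tendsto (fun L : ℕ => Finset.Icc (-(L : ℤ)) (L : ℤ)) atTop atTop := by
    refine tendsto_atTop_finset_of_monotone (fun L L' h => Finset.Icc_subset_Icc (by omega) (by omega))
      fun x => ⟨x.natAbs, ?_⟩
    rw [Finset.mem_Icc]; omega
  have hQlim : ∀ t : ℝ, |t| ≤ |τ| →
      Tendsto (fun L : ℕ => ∑ x ∈ Finset.Icc (-(L : ℤ)) (L : ℤ), c t x) atTop (𝓝 (∑' x, c t x)) :=
    fun t ht => (hsumc t ht).hasSum.comp hIcc
  -- (3) dominated convergence in `t ∈ Ι 0 τ`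
  have hIlim : Tendsto (fun L : ℕ => ∫ t in (0:ℝ)..τ, ∑ x ∈ Finset.Icc (-(L : ℤ)) (L : ℤ), c t x) atTop
      (𝓝 (∫ t in (0:ℝ)..τ, ∑' x, c t x)) := by
    refine intervalIntegral.tendsto_integral_filter_of_dominated_convergence (fun _ => ∑' w, Fm w) ?_ ?_
      intervalIntegrable_const ?_
    · exact Eventually.of_forall fun L =>
        (continuous_finsetSum _ fun x _ => hccont x).aestronglyMeasurable
    · exact Eventually.of_forall fun L => ae_of_all _ fun t ht => by
        rw [Real.norm_eq_abs]; exact hQbound L t (abs_le_abs_of_mem_uIoc ht)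
    · exact ae_of_all _ fun t ht => hQlim t (abs_le_abs_of_mem_uIoc ht)
  -- (4) conclusion
  have hlim2 : Tendsto (fun L : ℕ => |τ⁻¹ * ∫ t in (0:ℝ)..τ, ∑ x ∈ Finset.Icc (-(L : ℤ)) (L : ℤ), c t x|)
      atTop (𝓝 |τ⁻¹ * ∫ t in (0:ℝ)..τ, ∑' x, c t x|) := (hIlim.const_mul τ⁻¹).abs
  refine le_of_tendsto hlim2 (eventually_atTop.2 ⟨L₀, fun L hL => ?_⟩)
  have h := hL₀ L hL
  rw [intervalIntegral.integral_congr fun t _ => hE1 L t] at h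
  exact h

end Summit.AtomisticToContinuum.FouriersLaw.Theorems.NonBallistic.DrudeFromTruncation

namespace Summit.AtomisticToContinuum.FouriersLaw.Theorems.NonBallistic

open MeasureTheory ProbabilityTheory Filter Topology
open scoped NNReal ENNReal BigOperators
open Literature.MathematicalPhysics.KineticTheory
open Literature.MathematicalPhysics.KineticTheory.HeatConduction
open Summit.AtomisticToContinuum.FouriersLaw.Theorems.NonBallistic.DrudeFromTruncation

/-- **Registered sub-goal `stub_truncatedCesaroBoxLimit`** (stub `stub_drudeFromTruncationRegular`, DFT′, line
`drude-controls-conductance`, R3b): the `NoTruncatedDrude` Cesàro bound passes from the box observables `G_L` to the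
space-summed truncated autocorrelation of the clipped current as `L → ∞` at fixed `τ`
(`cesaro_tsum_cov_clipCurrent_le`, closed form). [folklore] -/
theorem stub_truncatedCesaroBoxLimit :
    ∀ (P : OscillatorChain) (s₁ s₂ : ℕ), 1 ≤ s₁ → 1 ≤ s₂ → OscillatorChain.IsEvenPolyOfDegree P.U s₁ → OscillatorChain.IsEvenPolyOfDegree P.V s₂ → ∀ D : InfiniteChainDynamics P, D.carrier = P.bmGood → (∀ (t : ℝ) (σ : ChainConfig), σ ∉ P.bmGood → D.flow t σ = σ) → ∀ (T : ℝ) (μ : Measure ChainConfig), P.IsChainGibbsMeasure T μ → IsShiftInvariant μ → P.HasSuperstabilityEstimate μ → D.PreservesMeasure μ → ∀ C m : ℝ, 0 ≤ C → 0 < m → (∀ (a : ℤ) (n : ℕ) (f g : ChainConfig → ℝ), DependsOn f {i : ℤ | i ≤ a} → DependsOn g {i : ℤ | a + n ≤ i} → Measurable f → Measurable g → MemLp f 2 μ → MemLp g 2 μ → |∫ σ, f σ * g σ ∂μ - (∫ σ, f σ ∂μ) * ∫ σ, g σ ∂μ| ≤ C * Real.exp (-(m * n)) * (∫ σ, f σ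 ^ 2 ∂μ) ^ (1 / 2 : ℝ) * (∫ σ, g σ ^ 2 ∂μ) ^ (1 / 2 : ℝ)) → ∀ (M : ℝ), 0 < M → ∀ (η : ℝ), (∃ τ₀ : ℝ, ∀ τ : ℝ, τ₀ ≤ τ → ∃ L₀ : ℕ, ∀ L : ℕ, L₀ ≤ L → |τ⁻¹ * ∫ t in (0:ℝ)..τ, ((∫ σ, max (-M) (min M (P.bondCurrentZ (D.flow t σ) 0)) * (∑ x ∈ Finset.Icc (-(L : ℤ)) (L : ℤ), max (-M) (min M (P.bondCurrentZ σ x))) ∂μ) - (∫ σ, max (-M) (min M (P.bondCurrentZ (D.flow t σ) 0)) ∂μ) * (∫ σ, ∑ x ∈ Finset.Icc (-(L : ℤ)) (L : ℤ), max (-M) (min M (P.bondCurrentZ σ x)) ∂μ))| ≤ η) → ∃ τ₀ : ℝ, ∀ τ : ℝ, τ₀ ≤ τ → |τ⁻¹ * ∫ t in (0:ℝ)..τ, (∑' x : ℤ, cov[(fun σ : ChainConfig => max (-M) (min M (P.bondCurrentZ σ 0))), ((fun σ : ChainConfig => max (-M) (min M (P.bondCurrentZ σ 0))) ∘ D.flow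 t) ∘ chainShift x; μ])| ≤ η :=
  fun _ _ _ hs₁ hs₂ hU1 hV1 D hcar hid _ _ hG hS hss hD _ _ hC hm hmix _ hM _ hH =>
    cesaro_tsum_cov_clipCurrent_le hs₁ hs₂ hU1 hV1 D hcar hid hG hS hss hD hC hm hmix hM hH

end Summit.AtomisticToContinuum.FouriersLaw.Theorems.NonBallistic

end
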